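import Summits.QuantumFields.BalabanUV.Beta.GAN24.DerivativeRateTransferJensen

/-!
# `BalabanUV.Beta.GAN24.DerivativeRateTransferJensenLattice` — binder row G-an2-4 ∕ (CONV-C), route R6 «VALUES, NOT DERIVATIVES», PART 24:
# THE BLOCK-LATTICE INSTANCE OF THE COVARIANT JENSEN INEQUALITY — PART 22's combinatorial hypotheses (block weights, weight-carrying pairings,
# straight chains, q-weighted multiplicity `L·L^{−d}`, Gram count `d·L^{−d}`) DISCHARGED for the `d`-dimensional block geometry
# «coarse torus `(ℤ∕M)^d`, blocks of side `L`», so that (STAB-ε,δ) ∕ (STAB) hold there for ANY orthogonal transporter data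
# (unit b2b-balaban-gan24-p3, gen 37; v1)

NOT IN PRINT; OUR PROOF (for the ROUTE; [folklore] finite combinatorics of the block lattice + PART 22 BY NAME).  HONEST FRAMING (cell contract, verbatim):
«discharging `BetaPertH` makes Bałaban's UV stability UNCONDITIONAL — a real constructive-QFT result; it is NOT the continuum limit and NOT the Clay
problem.»  HONEST DEPENDENCY (verbatim): «continuum YM on T⁴ ⇐ BetaPertH ∧ nine spine estimates (0/9 proved); BetaPertH ⇐ (D1) ∧ (D4) ∧ CAP+tail; G-an2-4
gates asym, D1 and NE2/3/4.»

THE GEOMETRY (no `def`: the objects are spelled out in the statements).  Coarse sites `y : Fin d → ZMod M`; fine sites `x = (x.1, x.2)` = (block label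
`Fin d → ZMod M`, position in the block `Fin d → Fin L`); block weights `q y x = [x.1 = y]·(L^d)⁻¹`; coarse bonds `(y, μ)` from `y` to `y + e_μ`
(`e_μ = Pi.single μ 1`); the pairing `σ_{(y,μ)} x = (x.1 + e_μ, x.2)` (translation by one block = `L` fine steps); fine bonds `(x, μ)` from `x` to the next
site in direction `μ` WITH CARRY into the next block; the chain from `x` to `σx`: `xs μ x i = (x.1 + ((x.2 μ + i) ∕ L)•e_μ, x.2[μ ↦ (x.2 μ + i) % L])`,
`i = 0, …, L`.  RESULTS: `Σ_x q y x = 1`; `q (y + e_μ) (σx) = q y x`; `xs μ x 0 = x`, `xs μ x L = σ x`, `tgt (xs μ x i, μ) = xs μ x (i+1)`; the q-weighted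
multiplicity of the chain system through any fine bond is EXACTLY `L·(L^d)⁻¹`; the Gram count is EXACTLY `d·(L^d)⁻¹`; hence (§3) PART 22's
`covJensen_holonomy` ∕ `covJensen_flat` on this geometry for any colour space `o`, any orthogonal `R, R′, W`, any fine ∕ coarse forms dominating ∕ dominated by
the covariant bond energies with `w_c·L·(L·(L^d)⁻¹) ≤ w_f`.

WHAT IT DOES NOT DO: choose Bałaban's contours for `W` or his transporters (DATA here); bound `κ`; vector fields.  SUPPLIER work on route R6 (rank 2,
REDUCTION, no seat); no consumer of record; NEVER «G-an2-4 closed»; NOT (CONV-C), NOT D1, NOT `BetaPertH`, NOT continuum, NOT Clay.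
Records: `HOME/b2b-balaban-gan24-p3/WOODBURY-FIBRE.md` v13.7.
-/

noncomputable section

open Matrix Finset Function

namespace Summit.QuantumFields.BalabanUV.Beta.GAN24.DerivativeRateTransferJensenLattice

open Summit.QuantumFields.BalabanUV.Beta.GAN24.DerivativeRateTransferJensen

variable {d L M : ℕ}

/-! ## §1 Block weights, pairings, Gram count -/

section Weights

/-- **BLOCK WEIGHTS SUM TO ONE**: `Σ_x [x.1 = y]·(L^d)⁻¹ = 1` (a block has `L^d` sites). [folklore] -/
theorem sum_blockWeight [NeZero L] [NeZero M] (y : Fin d → ZMod M) :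
    ∑ x : (Fin d → ZMod M) × (Fin d → Fin L), (if x.1 = y then ((L : ℝ) ^ d)⁻¹ else 0) = 1 := by
  rw [Fintype.sum_prod_type, Finset.sum_comm]
  dsimp only
  simp only [Finset.sum_ite_eq', Finset.mem_univ, if_true, Finset.sum_const, Finset.card_univ, Fintype.card_fun, Fintype.card_fin,
    nsmul_eq_mul]
  have hL : ((L : ℝ) ^ d) ≠ 0 := pow_ne_zero _ (Nat.cast_ne_zero.mpr (NeZero.ne L))
  push_cast; field_simp

/-- the block weights are nonnegative. [folklore] -/
theorem blockWeight_nonneg (y : Fin d → ZMod M) (x : (Fin d → ZMod M) × (Fin d → Fin L)) :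
    0 ≤ (if x.1 = y then ((L : ℝ) ^ d)⁻¹ else 0) := by
  split_ifs
  · positivity
  · exact le_rfl

/-- **THE PAIRING CARRIES THE WEIGHTS**: `q (y + e_μ) (x.1 + e_μ, x.2) = q y x`. [folklore] -/
theorem blockWeight_pair (y e : Fin d → ZMod M) (x : (Fin d → ZMod M) × (Fin d → Fin L)) :
    (if ((Equiv.addRight e).prodCongr (Equiv.refl (Fin d → Fin L)) x).1 = y + e then ((L : ℝ) ^ d)⁻¹ else 0) =
      (if x.1 = y then ((L : ℝ) ^ d)⁻¹ else 0) := by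
  simp only [Equiv.prodCongr_apply, Prod.map_fst, Equiv.coe_addRight, add_left_inj]

/-- **THE GRAM COUNT IS `d·(L^d)⁻¹`**: `Σ_{(y,μ)} q (y + e_μ) x′ = d·(L^d)⁻¹` (for each direction exactly one block is paired onto the block of `x′`). [folklore] -/
theorem sum_blockWeight_tgt [NeZero M] (x' : (Fin d → ZMod M) × (Fin d → Fin L)) :
    ∑ e' : (Fin d → ZMod M) × Fin d, (if x'.1 = e'.1 + Pi.single e'.2 1 then ((L : ℝ) ^ d)⁻¹ else 0) = d * ((L : ℝ) ^ d)⁻¹ := by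
  rw [Fintype.sum_prod_type]
  simp only
  rw [Finset.sum_comm]
  have h : ∀ μ : Fin d, ∑ y : Fin d → ZMod M, (if x'.1 = y + Pi.single μ 1 then ((L : ℝ) ^ d)⁻¹ else 0) = ((L : ℝ) ^ d)⁻¹ := fun μ => by
    rw [← Equiv.sum_comp (Equiv.addRight (-(Pi.single μ (1 : ZMod M))))]
    simp only [Equiv.coe_addRight, neg_add_cancel_right]
    rw [Finset.sum_ite_eq Finset.univ x'.1]
    simp
  simp only [h, Finset.sum_const, Finset.card_univ, Fintype.card_fin, nsmul_eq_mul]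

end Weights

/-! ## §2 Straight chains with carry: endpoints, bond structure, multiplicity -/

section Chains

/-- position-with-carry arithmetic: `(a + 0) % L`-type facts are `Nat` lemmas; here `(x.2 μ + 0) ∕ L = 0` and `% L = x.2 μ`. [folklore] -/
theorem chain_zero (hL : 0 < L) (μ : Fin d) (x : (Fin d → ZMod M) × (Fin d → Fin L)) :
    ((x.1 + (((x.2 μ : ℕ) + 0) / L) • (Pi.single μ (1 : ZMod M)),
      update x.2 μ ⟨((x.2 μ : ℕ) + 0) % L, Nat.mod_lt _ hL⟩) : (Fin d → ZMod M) × (Fin d → Fin L)) = x := by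
  have h1 : ((x.2 μ : ℕ) + 0) / L = 0 := by rw [add_zero]; exact Nat.div_eq_of_lt (x.2 μ).isLt
  have h2 : (⟨((x.2 μ : ℕ) + 0) % L, Nat.mod_lt _ hL⟩ : Fin L) = x.2 μ := by
    ext; simp [Nat.mod_eq_of_lt (x.2 μ).isLt]
  rw [h1, zero_smul, add_zero, h2, update_eq_self]

/-- the chain ends one block further: `(x.2 μ + L) ∕ L = 1`, `% L = x.2 μ`. [folklore] -/
theorem chain_end (hL : 0 < L) (μ : Fin d) (x : (Fin d → ZMod M) × (Fin d → Fin L)) :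
    ((x.1 + (((x.2 μ : ℕ) + L) / L) • (Pi.single μ (1 : ZMod M)),
      update x.2 μ ⟨((x.2 μ : ℕ) + L) % L, Nat.mod_lt _ hL⟩) : (Fin d → ZMod M) × (Fin d → Fin L)) =
      (x.1 + Pi.single μ 1, x.2) := by
  have h1 : ((x.2 μ : ℕ) + L) / L = 1 := by
    rw [Nat.add_div_right _ hL, Nat.div_eq_of_lt (x.2 μ).isLt]
  have h2 : (⟨((x.2 μ : ℕ) + L) % L, Nat.mod_lt _ hL⟩ : Fin L) = x.2 μ := by
    ext; simp [Nat.mod_eq_of_lt (x.2 μ).isLt]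
  rw [h1, one_smul, h2, update_eq_self]

/-- **ONE FINE STEP WITH CARRY CONTINUES THE CHAIN**: the next site after `xs μ x i` in direction `μ` is `xs μ x (i+1)`. [folklore] -/
theorem chain_step (hL : 0 < L) (μ : Fin d) (x : (Fin d → ZMod M) × (Fin d → Fin L)) (i : ℕ) :
    (let z : (Fin d → ZMod M) × (Fin d → Fin L) :=
        (x.1 + (((x.2 μ : ℕ) + i) / L) • (Pi.single μ (1 : ZMod M)), update x.2 μ ⟨((x.2 μ : ℕ) + i) % L, Nat.mod_lt _ hL⟩);
      ((z.1 + (((z.2 μ : ℕ) + 1) / L) • (Pi.single μ (1 : ZMod M)), update z.2 μ ⟨((z.2 μ : ℕ) + 1) % L, Nat.mod_lt _ hL⟩) :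
        (Fin d → ZMod M) × (Fin d → Fin L))) =
      (x.1 + (((x.2 μ : ℕ) + (i + 1)) / L) • (Pi.single μ (1 : ZMod M)), update x.2 μ ⟨((x.2 μ : ℕ) + (i + 1)) % L, Nat.mod_lt _ hL⟩) := by
  dsimp only
  simp only [update_self, update_idem]
  have hdiv : ((x.2 μ : ℕ) + i) / L + (((x.2 μ : ℕ) + i) % L + 1) / L = ((x.2 μ : ℕ) + (i + 1)) / L := by
    conv_rhs => rw [← add_assoc, ← Nat.div_add_mod ((x.2 μ : ℕ) + i) L, add_assoc, Nat.mul_add_div hL]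
  have hmod : (((x.2 μ : ℕ) + i) % L + 1) % L = ((x.2 μ : ℕ) + (i + 1)) % L := by
    rw [Nat.mod_add_mod, add_assoc]
  refine Prod.ext ?_ ?_
  · simp only
    rw [add_assoc, ← add_smul, hdiv]
  · simp only
    congr 1
    exact Fin.ext hmod

/-- [folklore] a sum of a conditionally-zero family: `Σ_i (if c then f i else 0) = if c then Σ_i f i else 0` (condition independent of `i`). -/
theorem sum_ite_const_cond {ι : Type*} (s : Finset ι) (c : Prop) [Decidable c] (f : ι → ℝ) :
    ∑ i ∈ s, (if c then f i else 0) = if c then ∑ i ∈ s, f i else 0 := by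
  split_ifs <;> simp

/-- **THE `i`-TH CHAIN POINT IS A BIJECTION OF THE FINE SITES** (translation by `i` fine steps with carry): injectivity. [folklore] -/
theorem chain_injective [NeZero M] (hL : 0 < L) (μ : Fin d) (i : ℕ) :
    Function.Injective fun x : (Fin d → ZMod M) × (Fin d → Fin L) =>
      ((x.1 + (((x.2 μ : ℕ) + i) / L) • (Pi.single μ (1 : ZMod M)),
        update x.2 μ ⟨((x.2 μ : ℕ) + i) % L, Nat.mod_lt _ hL⟩) : (Fin d → ZMod M) × (Fin d → Fin L)) := by
  intro x x' h
  simp only [Prod.mk.injEq] at h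
  obtain ⟨h1, h2⟩ := h
  -- the `μ`-coordinates agree mod `L`, hence agree
  have hμ : (x.2 μ : ℕ) = (x'.2 μ : ℕ) := by
    have hm : ((x.2 μ : ℕ) + i) % L = ((x'.2 μ : ℕ) + i) % L := by
      have := congrArg (fun f => ((f μ : Fin L) : ℕ)) h2
      simpa only [update_self] using this
    have hme : (x.2 μ : ℕ) % L = (x'.2 μ : ℕ) % L :=
      Nat.ModEq.add_right_cancel' i hm
    rwa [Nat.mod_eq_of_lt (x.2 μ).isLt, Nat.mod_eq_of_lt (x'.2 μ).isLt] at hme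
  have h2' : x.2 = x'.2 := by
    funext ν
    by_cases hν : ν = μ
    · subst hν; exact Fin.ext hμ
    · have := congrArg (fun f => f ν) h2
      simpa only [update_of_ne hν] using this
  have h1' : x.1 = x'.1 := by
    rw [hμ] at h1
    exact add_right_cancel h1
  exact Prod.ext h1' h2'

/-- the fibre sum over a bijection of the fine sites: `Σ_x [chain_i(x) = z]·c = c`. [folklore] -/
theorem sum_ite_chain_eq [NeZero M] (hL : 0 < L) (μ : Fin d) (i : ℕ) (z : (Fin d → ZMod M) × (Fin d → Fin L)) (c : ℝ) :
    ∑ x : (Fin d → ZMod M) × (Fin d → Fin L),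
      (if ((x.1 + (((x.2 μ : ℕ) + i) / L) • (Pi.single μ (1 : ZMod M)),
            update x.2 μ ⟨((x.2 μ : ℕ) + i) % L, Nat.mod_lt _ hL⟩) : (Fin d → ZMod M) × (Fin d → Fin L)) = z then c else 0) = c := by
  haveI : NeZero L := ⟨hL.ne'⟩
  have hbij := (Finite.injective_iff_bijective.mp (chain_injective (M := M) hL μ i))
  have h := Equiv.sum_comp (Equiv.ofBijective _ hbij) (fun w => if w = z then c else 0)
  simp only [Equiv.ofBijective_apply] at h
  rw [h, Finset.sum_ite_eq']
  simp

/-- **THE q-WEIGHTED MULTIPLICITY OF THE STRAIGHT CHAINS THROUGH A FINE BOND IS EXACTLY `L·(L^d)⁻¹`.** [folklore] -/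
theorem sum_chainWeight [NeZero M] (hL : 0 < L) (e : ((Fin d → ZMod M) × (Fin d → Fin L)) × Fin d) :
    ∑ e' : (Fin d → ZMod M) × Fin d, ∑ x : (Fin d → ZMod M) × (Fin d → Fin L), ∑ i ∈ range L,
      (if (((x.1 + (((x.2 e'.2 : ℕ) + i) / L) • (Pi.single e'.2 (1 : ZMod M)),
              update x.2 e'.2 ⟨((x.2 e'.2 : ℕ) + i) % L, Nat.mod_lt _ hL⟩) : (Fin d → ZMod M) × (Fin d → Fin L)), e'.2) = e
        then (if x.1 = e'.1 then ((L : ℝ) ^ d)⁻¹ else 0) else 0) = L * ((L : ℝ) ^ d)⁻¹ := by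
  haveI : NeZero L := ⟨hL.ne'⟩
  obtain ⟨z, μ'⟩ := e
  rw [Fintype.sum_prod_type_right]
  dsimp only
  -- only the direction `μ'` contributes
  rw [Finset.sum_eq_single μ' (fun μ _ hμ => by simp [Prod.mk.injEq, hμ]) (fun h => (h (Finset.mem_univ _)).elim)]
  simp only [Prod.mk.injEq, and_true]
  -- bring the block-label sum innermost and evaluate it
  rw [Finset.sum_comm]
  have hy : ∀ (x : (Fin d → ZMod M) × (Fin d → Fin L)) (i : ℕ),
      ∑ y : Fin d → ZMod M,
        (if ((x.1 + (((x.2 μ' : ℕ) + i) / L) • (Pi.single μ' (1 : ZMod M)),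
              update x.2 μ' ⟨((x.2 μ' : ℕ) + i) % L, Nat.mod_lt _ hL⟩) : (Fin d → ZMod M) × (Fin d → Fin L)) = z
          then (if x.1 = y then ((L : ℝ) ^ d)⁻¹ else 0) else 0) =
      (if ((x.1 + (((x.2 μ' : ℕ) + i) / L) • (Pi.single μ' (1 : ZMod M)),
            update x.2 μ' ⟨((x.2 μ' : ℕ) + i) % L, Nat.mod_lt _ hL⟩) : (Fin d → ZMod M) × (Fin d → Fin L)) = z
        then ((L : ℝ) ^ d)⁻¹ else 0) := fun x i => by
    rw [sum_ite_const_cond, Finset.sum_ite_eq]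
    simp
  have hswap : ∀ x : (Fin d → ZMod M) × (Fin d → Fin L),
      ∑ y : Fin d → ZMod M, ∑ i ∈ range L,
        (if ((x.1 + (((x.2 μ' : ℕ) + i) / L) • (Pi.single μ' (1 : ZMod M)),
              update x.2 μ' ⟨((x.2 μ' : ℕ) + i) % L, Nat.mod_lt _ hL⟩) : (Fin d → ZMod M) × (Fin d → Fin L)) = z
          then (if x.1 = y then ((L : ℝ) ^ d)⁻¹ else 0) else 0) =
      ∑ i ∈ range L, (if ((x.1 + (((x.2 μ' : ℕ) + i) / L) • (Pi.single μ' (1 : ZMod M)),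
              update x.2 μ' ⟨((x.2 μ' : ℕ) + i) % L, Nat.mod_lt _ hL⟩) : (Fin d → ZMod M) × (Fin d → Fin L)) = z
          then ((L : ℝ) ^ d)⁻¹ else 0) := fun x => by
    rw [Finset.sum_comm]
    exact Finset.sum_congr rfl fun i _ => hy x i
  simp_rw [hswap]
  rw [Finset.sum_comm]
  simp_rw [sum_ite_chain_eq hL μ' _ z]
  simp

end Chains

/-! ## §3 THE END: (STAB-ε,δ) and (STAB) on the block lattice for any orthogonal transporter data -/

section End

variable {o : Type*} [Fintype o] [DecidableEq o]

/-- **`covJensen_holonomy_lattice` — THE COVARIANT JENSEN INEQUALITY ON THE BLOCK LATTICE** [our proof; PART 22 `covJensen_holonomy` with its combinatorial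
hypotheses DISCHARGED by §1–§2].  Data: block side `L ≥ 1`, coarse torus `(ℤ∕M)^d`, colours `o`; ORTHOGONAL fine bond transporters `R (x, μ)`, coarse bond
transporters `R′ (y, μ)`, block transporters `W y x`; partial transports `T` along the straight chains (recursion displayed); a fine form `H_f` dominating
`w_f·Σ|D_e u|²`, a coarse form `H_c` dominated by `w_c·Σ|D′_{e′}v|²`, the transported block averaging `Q`; weights `w_c·L·(L·(L^d)⁻¹) ≤ w_f`; loop holonomies
within `κ` of `1`.  Then for every `t > 0` and every `u`: `⟨Qu, H_cQu⟩ ≤ (1+t)⟨u, H_f u⟩ + (1+t⁻¹)·κ²·w_c·(d·(L^d)⁻¹)·|u|²`. -/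
theorem covJensen_holonomy_lattice [NeZero M] (hL : 0 < L)
    {R : ((Fin d → ZMod M) × (Fin d → Fin L)) × Fin d → Matrix o o ℝ} (hR : ∀ e, (R e)ᵀ * R e = 1)
    {R' : (Fin d → ZMod M) × Fin d → Matrix o o ℝ}
    {W : (Fin d → ZMod M) → (Fin d → ZMod M) × (Fin d → Fin L) → Matrix o o ℝ} (hW : ∀ y x, (W y x)ᵀ * W y x = 1)
    {Q : Matrix ((Fin d → ZMod M) × o) (((Fin d → ZMod M) × (Fin d → Fin L)) × o) ℝ}
    (hQ : ∀ (u : ((Fin d → ZMod M) × (Fin d → Fin L)) × o → ℝ) (y : Fin d → ZMod M),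
      (fun a => (Q *ᵥ u) (y, a)) = ∑ x, (if x.1 = y then ((L : ℝ) ^ d)⁻¹ else 0) • (W y x *ᵥ fun b => u (x, b)))
    {Hf : Matrix (((Fin d → ZMod M) × (Fin d → Fin L)) × o) (((Fin d → ZMod M) × (Fin d → Fin L)) × o) ℝ}
    {Hc : Matrix ((Fin d → ZMod M) × o) ((Fin d → ZMod M) × o) ℝ} {wf wc : ℝ} (hwc : 0 ≤ wc)
    (hHc : ∀ v : (Fin d → ZMod M) × o → ℝ, v ⬝ᵥ (Hc *ᵥ v) ≤
      wc * ∑ e' : (Fin d → ZMod M) × Fin d, ((R' e' *ᵥ fun a => v (e'.1 + Pi.single e'.2 1, a)) - fun a => v (e'.1, a)) ⬝ᵥ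
        ((R' e' *ᵥ fun a => v (e'.1 + Pi.single e'.2 1, a)) - fun a => v (e'.1, a)))
    (hHf : ∀ u : ((Fin d → ZMod M) × (Fin d → Fin L)) × o → ℝ,
      wf * ∑ e : ((Fin d → ZMod M) × (Fin d → Fin L)) × Fin d,
        ((R e *ᵥ fun b => u ((e.1.1 + ((((e.1.2 e.2 : ℕ) + 1) / L) • (Pi.single e.2 (1 : ZMod M))),
            update e.1.2 e.2 ⟨((e.1.2 e.2 : ℕ) + 1) % L, Nat.mod_lt _ hL⟩), b)) - fun b => u (e.1, b)) ⬝ᵥ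
          ((R e *ᵥ fun b => u ((e.1.1 + ((((e.1.2 e.2 : ℕ) + 1) / L) • (Pi.single e.2 (1 : ZMod M))),
            update e.1.2 e.2 ⟨((e.1.2 e.2 : ℕ) + 1) % L, Nat.mod_lt _ hL⟩), b)) - fun b => u (e.1, b)) ≤ u ⬝ᵥ (Hf *ᵥ u))
    {T : (Fin d → ZMod M) × Fin d → (Fin d → ZMod M) × (Fin d → Fin L) → ℕ → Matrix o o ℝ} (hT0 : ∀ e' x, T e' x 0 = 1)
    (hT : ∀ e' x i, i < L → T e' x (i + 1) = T e' x i *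
      R (((x.1 + (((x.2 e'.2 : ℕ) + i) / L) • (Pi.single e'.2 (1 : ZMod M)),
            update x.2 e'.2 ⟨((x.2 e'.2 : ℕ) + i) % L, Nat.mod_lt _ hL⟩) : (Fin d → ZMod M) × (Fin d → Fin L)), e'.2))
    (hw : wc * L * (L * ((L : ℝ) ^ d)⁻¹) ≤ wf) {κ : ℝ}
    (hV : ∀ e' x (w : o → ℝ),
      (((W e'.1 x)ᵀ * R' e' * W (e'.1 + Pi.single e'.2 1) (x.1 + Pi.single e'.2 1, x.2) * (T e' x L)ᵀ - 1) *ᵥ w) ⬝ᵥ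
          (((W e'.1 x)ᵀ * R' e' * W (e'.1 + Pi.single e'.2 1) (x.1 + Pi.single e'.2 1, x.2) * (T e' x L)ᵀ - 1) *ᵥ w) ≤ κ ^ 2 * (w ⬝ᵥ w))
    {t : ℝ} (ht : 0 < t) (u : ((Fin d → ZMod M) × (Fin d → Fin L)) × o → ℝ) :
    (Q *ᵥ u) ⬝ᵥ (Hc *ᵥ (Q *ᵥ u)) ≤ (1 + t) * (u ⬝ᵥ (Hf *ᵥ u)) + (1 + t⁻¹) * κ ^ 2 * wc * (d * ((L : ℝ) ^ d)⁻¹) * (u ⬝ᵥ u) := by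
  haveI : NeZero L := ⟨hL.ne'⟩
  refine covJensen_holonomy (o := o) (μ := Fin d → ZMod M) (ν := (Fin d → ZMod M) × (Fin d → Fin L))
    (β := ((Fin d → ZMod M) × (Fin d → Fin L)) × Fin d) (β' := (Fin d → ZMod M) × Fin d)
    (q := fun (y : Fin d → ZMod M) (x : (Fin d → ZMod M) × (Fin d → Fin L)) => if x.1 = y then ((L : ℝ) ^ d)⁻¹ else 0)
    (W := W) (Q := Q) (src := fun e : ((Fin d → ZMod M) × (Fin d → Fin L)) × Fin d => e.1)
    (tgt := fun e : ((Fin d → ZMod M) × (Fin d → Fin L)) × Fin d =>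
      ((e.1.1 + ((((e.1.2 e.2 : ℕ) + 1) / L) • (Pi.single e.2 (1 : ZMod M))),
        update e.1.2 e.2 ⟨((e.1.2 e.2 : ℕ) + 1) % L, Nat.mod_lt _ hL⟩) : (Fin d → ZMod M) × (Fin d → Fin L)))
    (R := R) (src' := fun e' : (Fin d → ZMod M) × Fin d => e'.1)
    (tgt' := fun e' : (Fin d → ZMod M) × Fin d => e'.1 + Pi.single e'.2 1) (R' := R') (Hf := Hf) (Hc := Hc) (wf := wf) (wc := wc)
    (σ := fun e' : (Fin d → ZMod M) × Fin d => (Equiv.addRight (Pi.single e'.2 (1 : ZMod M))).prodCongr (Equiv.refl (Fin d → Fin L)))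
    (ℓ := L)
    (xs := fun (e' : (Fin d → ZMod M) × Fin d) (x : (Fin d → ZMod M) × (Fin d → Fin L)) (i : ℕ) =>
      ((x.1 + (((x.2 e'.2 : ℕ) + i) / L) • (Pi.single e'.2 (1 : ZMod M)),
        update x.2 e'.2 ⟨((x.2 e'.2 : ℕ) + i) % L, Nat.mod_lt _ hL⟩) : (Fin d → ZMod M) × (Fin d → Fin L)))
    (γ := fun (e' : (Fin d → ZMod M) × Fin d) (x : (Fin d → ZMod M) × (Fin d → Fin L)) (i : ℕ) =>
      (((x.1 + (((x.2 e'.2 : ℕ) + i) / L) • (Pi.single e'.2 (1 : ZMod M)),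
        update x.2 e'.2 ⟨((x.2 e'.2 : ℕ) + i) % L, Nat.mod_lt _ hL⟩) : (Fin d → ZMod M) × (Fin d → Fin L)), e'.2))
    (T := T) (m := L * ((L : ℝ) ^ d)⁻¹) (g := d * ((L : ℝ) ^ d)⁻¹) (κ := κ) (t := t)
    ?_ ?_ hW hR hQ hwc hHc ?hf ?_ ?_ ?_ ?_ ?_ hT0 hT ?_ ?_ hw hV ht u
  case hf =>
    -- `exact hHf` makes the kernel-external defeq check unfold the lattice sums; `convert` closes it structurally
    intro u'
    convert hHf u' using 6
  · exact fun y x => blockWeight_nonneg y x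
  · exact fun y => (sum_blockWeight y).le
  · exact fun e' x => blockWeight_pair e'.1 (Pi.single e'.2 1) x
  · exact fun e' x => chain_zero hL e'.2 x
  · intro e' x
    show _ = ((Equiv.addRight (Pi.single e'.2 (1 : ZMod M))).prodCongr (Equiv.refl (Fin d → Fin L))) x
    rw [chain_end hL e'.2 x]
    rfl
  · exact fun e' x i _ => rfl
  · exact fun e' x i _ => chain_step hL e'.2 x i
  · exact fun e => (sum_chainWeight hL e).le
  · exact fun x => (sum_blockWeight_tgt x).le

/-- **`covJensen_flat_lattice` — FLAT LOOPS ON THE BLOCK LATTICE: (STAB) WITH CONSTANT EXACTLY 1** [our proof; PART 22 `covJensen_flat` + §1–§2]: same data;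
if every loop holonomy is trivial, `W(y,x)ᵀ·R′_{(y,μ)}·W(y + e_μ, σx)·T_L(x)ᵀ = 1` (U = 1, pure gauges, or coarse transporters DEFINED as the induced
holonomies), then `⟨Qu, H_cQu⟩ ≤ ⟨u, H_f u⟩` for every `u`. -/
theorem covJensen_flat_lattice [NeZero M] (hL : 0 < L)
    {R : ((Fin d → ZMod M) × (Fin d → Fin L)) × Fin d → Matrix o o ℝ} (hR : ∀ e, (R e)ᵀ * R e = 1)
    {R' : (Fin d → ZMod M) × Fin d → Matrix o o ℝ}
    {W : (Fin d → ZMod M) → (Fin d → ZMod M) × (Fin d → Fin L) → Matrix o o ℝ} (hW : ∀ y x, (W y x)ᵀ * W y x = 1)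
    {Q : Matrix ((Fin d → ZMod M) × o) (((Fin d → ZMod M) × (Fin d → Fin L)) × o) ℝ}
    (hQ : ∀ (u : ((Fin d → ZMod M) × (Fin d → Fin L)) × o → ℝ) (y : Fin d → ZMod M),
      (fun a => (Q *ᵥ u) (y, a)) = ∑ x, (if x.1 = y then ((L : ℝ) ^ d)⁻¹ else 0) • (W y x *ᵥ fun b => u (x, b)))
    {Hf : Matrix (((Fin d → ZMod M) × (Fin d → Fin L)) × o) (((Fin d → ZMod M) × (Fin d → Fin L)) × o) ℝ}
    {Hc : Matrix ((Fin d → ZMod M) × o) ((Fin d → ZMod M) × o) ℝ} {wf wc : ℝ} (hwc : 0 ≤ wc)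
    (hHc : ∀ v : (Fin d → ZMod M) × o → ℝ, v ⬝ᵥ (Hc *ᵥ v) ≤
      wc * ∑ e' : (Fin d → ZMod M) × Fin d, ((R' e' *ᵥ fun a => v (e'.1 + Pi.single e'.2 1, a)) - fun a => v (e'.1, a)) ⬝ᵥ
        ((R' e' *ᵥ fun a => v (e'.1 + Pi.single e'.2 1, a)) - fun a => v (e'.1, a)))
    (hHf : ∀ u : ((Fin d → ZMod M) × (Fin d → Fin L)) × o → ℝ,
      wf * ∑ e : ((Fin d → ZMod M) × (Fin d → Fin L)) × Fin d,
        ((R e *ᵥ fun b => u ((e.1.1 + ((((e.1.2 e.2 : ℕ) + 1) / L) • (Pi.single e.2 (1 : ZMod M))),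
            update e.1.2 e.2 ⟨((e.1.2 e.2 : ℕ) + 1) % L, Nat.mod_lt _ hL⟩), b)) - fun b => u (e.1, b)) ⬝ᵥ
          ((R e *ᵥ fun b => u ((e.1.1 + ((((e.1.2 e.2 : ℕ) + 1) / L) • (Pi.single e.2 (1 : ZMod M))),
            update e.1.2 e.2 ⟨((e.1.2 e.2 : ℕ) + 1) % L, Nat.mod_lt _ hL⟩), b)) - fun b => u (e.1, b)) ≤ u ⬝ᵥ (Hf *ᵥ u))
    {T : (Fin d → ZMod M) × Fin d → (Fin d → ZMod M) × (Fin d → Fin L) → ℕ → Matrix o o ℝ} (hT0 : ∀ e' x, T e' x 0 = 1)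
    (hT : ∀ e' x i, i < L → T e' x (i + 1) = T e' x i *
      R (((x.1 + (((x.2 e'.2 : ℕ) + i) / L) • (Pi.single e'.2 (1 : ZMod M)),
            update x.2 e'.2 ⟨((x.2 e'.2 : ℕ) + i) % L, Nat.mod_lt _ hL⟩) : (Fin d → ZMod M) × (Fin d → Fin L)), e'.2))
    (hw : wc * L * (L * ((L : ℝ) ^ d)⁻¹) ≤ wf)
    (hflat : ∀ e' x, (W e'.1 x)ᵀ * R' e' * W (e'.1 + Pi.single e'.2 1) (x.1 + Pi.single e'.2 1, x.2) * (T e' x L)ᵀ = 1)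
    (u : ((Fin d → ZMod M) × (Fin d → Fin L)) × o → ℝ) :
    (Q *ᵥ u) ⬝ᵥ (Hc *ᵥ (Q *ᵥ u)) ≤ u ⬝ᵥ (Hf *ᵥ u) := by
  haveI : NeZero L := ⟨hL.ne'⟩
  refine covJensen_flat (o := o) (μ := Fin d → ZMod M) (ν := (Fin d → ZMod M) × (Fin d → Fin L))
    (β := ((Fin d → ZMod M) × (Fin d → Fin L)) × Fin d) (β' := (Fin d → ZMod M) × Fin d)
    (q := fun (y : Fin d → ZMod M) (x : (Fin d → ZMod M) × (Fin d → Fin L)) => if x.1 = y then ((L : ℝ) ^ d)⁻¹ else 0)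
    (W := W) (Q := Q) (src := fun e : ((Fin d → ZMod M) × (Fin d → Fin L)) × Fin d => e.1)
    (tgt := fun e : ((Fin d → ZMod M) × (Fin d → Fin L)) × Fin d =>
      ((e.1.1 + ((((e.1.2 e.2 : ℕ) + 1) / L) • (Pi.single e.2 (1 : ZMod M))),
        update e.1.2 e.2 ⟨((e.1.2 e.2 : ℕ) + 1) % L, Nat.mod_lt _ hL⟩) : (Fin d → ZMod M) × (Fin d → Fin L)))
    (R := R) (src' := fun e' : (Fin d → ZMod M) × Fin d => e'.1)
    (tgt' := fun e' : (Fin d → ZMod M) × Fin d => e'.1 + Pi.single e'.2 1) (R' := R') (Hf := Hf) (Hc := Hc) (wf := wf) (wc := wc)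
    (σ := fun e' : (Fin d → ZMod M) × Fin d => (Equiv.addRight (Pi.single e'.2 (1 : ZMod M))).prodCongr (Equiv.refl (Fin d → Fin L)))
    (ℓ := L)
    (xs := fun (e' : (Fin d → ZMod M) × Fin d) (x : (Fin d → ZMod M) × (Fin d → Fin L)) (i : ℕ) =>
      ((x.1 + (((x.2 e'.2 : ℕ) + i) / L) • (Pi.single e'.2 (1 : ZMod M)),
        update x.2 e'.2 ⟨((x.2 e'.2 : ℕ) + i) % L, Nat.mod_lt _ hL⟩) : (Fin d → ZMod M) × (Fin d → Fin L)))
    (γ := fun (e' : (Fin d → ZMod M) × Fin d) (x : (Fin d → ZMod M) × (Fin d → Fin L)) (i : ℕ) =>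
      (((x.1 + (((x.2 e'.2 : ℕ) + i) / L) • (Pi.single e'.2 (1 : ZMod M)),
        update x.2 e'.2 ⟨((x.2 e'.2 : ℕ) + i) % L, Nat.mod_lt _ hL⟩) : (Fin d → ZMod M) × (Fin d → Fin L)), e'.2))
    (T := T) (m := L * ((L : ℝ) ^ d)⁻¹)
    ?_ ?_ hW hR hQ hwc hHc ?hf ?_ ?_ ?_ ?_ ?_ hT0 hT ?_ hw hflat u
  case hf =>
    intro u'
    convert hHf u' using 6
  · exact fun y x => blockWeight_nonneg y x
  · exact fun y => (sum_blockWeight y).le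
  · exact fun e' x => blockWeight_pair e'.1 (Pi.single e'.2 1) x
  · exact fun e' x => chain_zero hL e'.2 x
  · intro e' x
    show _ = ((Equiv.addRight (Pi.single e'.2 (1 : ZMod M))).prodCongr (Equiv.refl (Fin d → Fin L))) x
    rw [chain_end hL e'.2 x]
    rfl
  · exact fun e' x i _ => rfl
  · exact fun e' x i _ => chain_step hL e'.2 x i
  · exact fun e => (sum_chainWeight hL e).le

end End

end Summit.QuantumFields.BalabanUV.Beta.GAN24.DerivativeRateTransferJensenLattice

end
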